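import Summits.AtomisticToContinuum.Crystallization.Theorems.PalmUnimodularRigidityUnimodularEnergyLowerBound
import Literature.Probability.Process.PointStationaryLaw
import HarnessLib

/-!
# Affine competitors of point-stationary hard-core laws are admissible
# (stub R2a″-A `stub_affineCompetitor` of line `palm-good-law`, crux stmt-AtomisticToContinuum-13603)

Stub `stub_affineCompetitor` of the skeleton `Cruxes/DefectFreeCrystallizes/Lines/palm_good_law.lean`
(`ReggeStarCoercivity.DefectFreeCrystallizes`), law-level structure input of the `e*`-free core R2a″.

**Statement.**  For every `δ > 0`, every point-stationary probability law `P` on rooted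
`δ`-hard-core configurations of `ℝ³` (`μ = count|S`, `0 ∈ S`, `S` `δ`-separated; Mecke identity
`IsPointStationaryLaw P`) and every continuous linear automorphism `A` of `ℝ³`,
`e* = ⨅_Q e_LJ(Q) ≤ E_P[½ Σ_{y ∈ μ} V_LJ(‖A y‖)]`: the `A`-deformed mean root energy is an
admissible competitor for the periodic ground-state energy.

**Proof.**  The image law `P_A := P ∘ (μ ↦ A_*μ)⁻¹` is again a point-stationary probability law on
rooted hard-core configurations, with hard core `δ / (‖A⁻¹‖ + 1)`:
* `A_*(count|S) = count|(A S)` (`map_count_restrict`, `A` a measurable bijection), `0 = A 0 ∈ A S`,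
  and `‖x - y‖ ≤ ‖A⁻¹‖·‖A x - A y‖` (`ContinuousLinearEquiv.antilipschitz`) gives the separation
  (`isRootedHardCore_map`);
* `μ ↦ A_*μ` is a measurable bijection of the Giry space with inverse `μ ↦ A⁻¹_*μ`
  (`measurableEmbedding_map`), so integrals against `P_A` are computed by substitution without any
  measurability of the integrand, and almost-sure properties transfer;
* MECKE TRANSFERS (`isPointStationaryLaw_map`): by linearity `θ_{A y}(A_*μ) = A_*(θ_y μ)`
  (`A ∘ (· - y) = (· - A y) ∘ A`) and `-(A y) = A (-y)`, so the Mecke identity of `P_A` for `g` is the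
  Mecke identity of `P` for the jointly measurable `g'(μ, y) := g(A_*μ, A y)`.
The LANDED floor `UnimodularEnergy.eStar_le_integral_rootEnergy` (item 9229, `e_uni ≥ e*`) applied to
`P_A` gives `e* ≤ E_{P_A}[h]`, and two substitutions (`MeasurableEmbedding.integral_map` on the Giry
space, `integral_map_equiv` on `ℝ³`) rewrite `E_{P_A}[h] = E_P[½ Σ_y V_LJ(‖A y‖)]`.  All `[folklore]`.
-/

noncomputable section

namespace Summit.AtomisticToContinuum.Crystallization.Theorems.PalmGoodLaw.AffineCompetitor

open MeasureTheory Set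
open scoped ENNReal
open Literature.MathematicalPhysics.StatisticalMechanics Literature.Probability.Process
open Summit.AtomisticToContinuum.Crystallization.Theorems.ChargedEnergyGapNegative (E3)

/-! ## Push-forward of configurations along a measurable bijection -/

section General

variable {E F : Type*} [MeasurableSpace E] [MeasurableSpace F]

/-- **Pushing configurations forward along a measurable bijection is a measurable embedding of the
Giry spaces** (indeed a measurable bijection `Measure E ≃ᵐ Measure F`, with inverse the push-forward
along `e.symm`). [folklore] -/
theorem measurableEmbedding_map (e : E ≃ᵐ F) :
    MeasurableEmbedding (fun μ : Measure E => μ.map e) :=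
  (⟨⟨fun μ => μ.map e, fun ν => ν.map e.symm, fun _ => e.map_symm_map, fun _ => e.map_map_symm⟩,
      Measure.measurable_map _ e.measurable, Measure.measurable_map _ e.symm.measurable⟩ :
    Measure E ≃ᵐ Measure F).measurableEmbedding

/-- A measurable bijection pushes the counting measure of `S` to the counting measure of its image,
`e_*(count|S) = count|(e S)`. [folklore] -/
theorem map_count_restrict [MeasurableSingletonClass E] [MeasurableSingletonClass F] (e : E ≃ᵐ F)
    (S : Set E) :
    ((Measure.count : Measure E).restrict S).map e =
      (Measure.count : Measure F).restrict (e '' S) := by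
  ext s hs
  rw [e.map_apply, Measure.restrict_apply hs, Measure.restrict_apply (e.measurable hs),
    ← image_preimage_inter e S s, Measure.count_injective_image e.injective]

end General

/-! ## Linear images of rooted hard-core configurations and of point-stationary laws -/

/-- **Linear images of rooted hard-core configurations are rooted hard-core configurations**: if
`μ = count|S` with `0 ∈ S` and `S` `δ`-separated, then `A_*μ = count|(A S)` with `0 = A 0 ∈ A S` and
`A S` `δ/(‖A⁻¹‖ + 1)`-separated (`‖x - y‖ ≤ ‖A⁻¹‖ ‖A x - A y‖`). [folklore] -/
theorem isRootedHardCore_map (A : E3 ≃L[ℝ] E3) {δ : ℝ} {μ : Measure E3}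
    (h : IsRootedHardCore δ μ) :
    IsRootedHardCore (δ / (‖(A.symm : E3 →L[ℝ] E3)‖ + 1)) (μ.map A) := by
  obtain ⟨S, h0, hsep, rfl⟩ := h
  refine ⟨A '' S, ⟨0, h0, map_zero A⟩, ?_, ?_⟩
  · rintro _ ⟨x, hx, rfl⟩ _ ⟨y, hy, rfl⟩ hne
    have hxy : x ≠ y := fun hxy => hne (by rw [hxy])
    have h1 : δ ≤ dist x y := hsep x hx y hy hxy
    have h2 : dist x y ≤ ‖(A.symm : E3 →L[ℝ] E3)‖ * dist (A x) (A y) := by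
      have h := A.antilipschitz.le_mul_dist x y
      rwa [coe_nnnorm] at h
    have hK : 0 ≤ ‖(A.symm : E3 →L[ℝ] E3)‖ := norm_nonneg _
    have hd : 0 ≤ dist (A x) (A y) := dist_nonneg
    rw [div_le_iff₀ (by positivity)]
    nlinarith
  · exact map_count_restrict A.toHomeomorph.toMeasurableEquiv S

/-- **Linear images of point-stationary laws are point-stationary** (Mecke transfers): for a
continuous linear automorphism `A` of `ℝ³`, re-rooting commutes with the push-forward,
`θ_{A y}(A_*μ) = A_*(θ_y μ)` and `-(A y) = A (-y)`, so the Mecke identity of the image law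
`P ∘ (μ ↦ A_*μ)⁻¹` for `g` is that of `P` for `g'(μ, y) = g(A_*μ, A y)`. [folklore] -/
theorem isPointStationaryLaw_map (A : E3 ≃L[ℝ] E3) {P : Measure (Measure E3)}
    (hP : IsPointStationaryLaw P) :
    IsPointStationaryLaw (P.map fun μ : Measure E3 => μ.map A) := by
  set Ae : E3 ≃ᵐ E3 := A.toHomeomorph.toMeasurableEquiv
  have hΦ : MeasurableEmbedding (fun μ : Measure E3 => μ.map A) := measurableEmbedding_map Ae
  have hAm : Measurable (A : E3 → E3) := A.continuous.measurable
  intro g hg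
  rw [hΦ.lintegral_map, hΦ.lintegral_map]
  -- the transported test function
  have hg' : Measurable (Function.uncurry fun (μ : Measure E3) (y : E3) => g (μ.map A) (A y)) :=
    hg.comp ((hΦ.measurable.comp measurable_fst).prodMk (hAm.comp measurable_snd))
  -- re-rooting commutes with the push-forward
  have hkey : ∀ (μ : Measure E3) (y : E3),
      (μ.map fun z => z - y).map A = (μ.map A).map fun z => z - A y := by
    intro μ y
    rw [Measure.map_map hAm (measurable_sub_const y),
      Measure.map_map (measurable_sub_const (A y)) hAm]
    congr 1
    funext z
    simp only [Function.comp_apply, map_sub]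
  calc ∫⁻ μ, ∫⁻ y, g (μ.map A) y ∂(μ.map A) ∂P
      = ∫⁻ μ, ∫⁻ y, g (μ.map A) (A y) ∂μ ∂P :=
        lintegral_congr fun μ : Measure E3 => lintegral_map_equiv (fun y => g (μ.map A) y) Ae
    _ = ∫⁻ μ, ∫⁻ y, g ((μ.map fun z => z - y).map A) (A (-y)) ∂μ ∂P := hP _ hg'
    _ = ∫⁻ μ, ∫⁻ y, g ((μ.map A).map fun z => z - A y) (-A y) ∂μ ∂P := by
        simp only [hkey, map_neg]
    _ = ∫⁻ μ, ∫⁻ y, g ((μ.map A).map fun z => z - y) (-y) ∂(μ.map A) ∂P :=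
        (lintegral_congr fun μ : Measure E3 =>
          lintegral_map_equiv (fun y => g ((μ.map A).map fun z => z - y) (-y)) Ae).symm

/-! ## The stub -/

/-- **R2a″-A `stub_affineCompetitor` — AFFINE COMPETITORS OF A POINT-STATIONARY HARD-CORE LAW ARE
ADMISSIBLE.**  For every point-stationary probability law `P` on rooted `δ`-hard-core configurations
of `ℝ³` (`δ > 0`) and every continuous linear automorphism `A` of `ℝ³`, the `A`-deformed mean root
energy of `P` is at least `e* = ⨅_Q e_LJ(Q)`: the image law `P ∘ (μ ↦ A_*μ)⁻¹` is a point-stationary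
probability law on rooted `δ/(‖A⁻¹‖ + 1)`-hard-core configurations (`isRootedHardCore_map`,
`isPointStationaryLaw_map`), so the landed floor `UnimodularEnergy.eStar_le_integral_rootEnergy`
(item 9229) applies to it, and two substitutions identify its mean root energy with
`E_P[½ Σ_y V_LJ(‖A y‖)]`. [folklore] -/
theorem stub_affineCompetitor :
    ∀ δ : ℝ, 0 < δ → ∀ P : Measure (Measure (EuclideanSpace ℝ (Fin 3))), IsProbabilityMeasure P →
      (∀ᵐ μ ∂P, IsRootedHardCore δ μ) → IsPointStationaryLaw P →
      ∀ A : EuclideanSpace ℝ (Fin 3) ≃L[ℝ] EuclideanSpace ℝ (Fin 3),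
        (⨅ Q : PeriodicConfiguration 3, Q.energyPerParticle lennardJones) ≤
          ∫ μ, (∫ y, lennardJones ‖A y‖ ∂μ) / 2 ∂P := by
  intro δ hδ P hP hcore hstat A
  set Ae : E3 ≃ᵐ E3 := A.toHomeomorph.toMeasurableEquiv
  have hΦ : MeasurableEmbedding (fun μ : Measure E3 => μ.map A) := measurableEmbedding_map Ae
  have hδ' : 0 < δ / (‖(A.symm : E3 →L[ℝ] E3)‖ + 1) := div_pos hδ (by positivity)
  haveI : IsProbabilityMeasure (P.map fun μ : Measure E3 => μ.map A) :=
    Measure.isProbabilityMeasure_map hΦ.measurable.aemeasurable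
  have hcore' : ∀ᵐ μ' ∂(P.map fun μ : Measure E3 => μ.map A),
      IsRootedHardCore (δ / (‖(A.symm : E3 →L[ℝ] E3)‖ + 1)) μ' :=
    hΦ.ae_map_iff.2 (hcore.mono fun μ hμ => isRootedHardCore_map A hμ)
  have hstat' : IsPointStationaryLaw (P.map fun μ : Measure E3 => μ.map A) :=
    isPointStationaryLaw_map A hstat
  have h := UnimodularEnergy.eStar_le_integral_rootEnergy hδ' hcore' hstat'
  rw [hΦ.integral_map] at h
  have hinner : ∀ μ : Measure E3,
      ∫ y, lennardJones ‖y‖ ∂(μ.map A) = ∫ y, lennardJones ‖A y‖ ∂μ :=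
    fun μ => integral_map_equiv Ae _
  simp only [hinner] at h
  exact h

end Summit.AtomisticToContinuum.Crystallization.Theorems.PalmGoodLaw.AffineCompetitor

end
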